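import Summits.SmoothPoincare4.SmoothPoincare4.Theorems.ConvexBisectionAcyclicBisectionExistsSeamTwistSignFlatOff
import HarnessLib

/-!
# Seam transport, ST4 (4c): the flat part of `∂ Base g` off the cores of a Lefschetz link is connected
(wave 5, brick X3-4b of sub-node ST4 `node_ST4_twistSign` of node T3c-2 `node_seam_transport` of stub
`stub_T3_dualPresentation` (T3), line `modp-braid-orbits`, crux `ConvexBisection.AcyclicBisectionExists`,
item stmt-SmoothPoincare4-10508; registered sub-goal `helper_flatOffCores_preconnected`)

Sequel of `…SeamTwistSignFlatOff.lean` (`flatOff h`, non-critical pages, core-free points of every page,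
rotation arcs).  **`flatOff h` is PRECONNECTED** (`isPreconnected_flatOff`, registered as
`helper_flatOffCores_preconnected` in its form on the boundary 3-manifold `(bBase g).carrier`), WITHOUT
general position.  The proof is a clopen argument on the ANGLE: for a component `C` of `flatOff h`,
the set of angles `t` such that `C` meets direction `e^{it}` is open (rotation arcs stay in `flatOff h`
for a short time) and closed (rotate the core-free point of the limit page into a nearby realised
NON-CRITICAL page — realised angles form an open set and critical angles are locally finite — whose
whole page lies in `C`), hence all of `ℝ`; so every page meets `C`, every non-critical page lies in `C`,
and every point of a critical page off the cores rotates into `C`.  §5 transfers the statement to the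
boundary 3-manifold through the embedding `∂ Base g ↪ Base g`.

Everything is proved; no named facts, no `sorry`.  References: J. B. Etnyre, T. Fuller, IMRN 2006,
Thm. 1 (proof, p. 8) [EtnyreFuller2006]; J. Milnor, *Singular points of complex hypersurfaces* (1968),
§9 [Milnor1968].
-/

noncomputable section

set_option linter.dupNamespace false

open scoped Manifold ContDiff Topology Real

namespace Summit.SmoothPoincare4.SmoothPoincare4.Theorems.AcyclicBisectionExists.ModpBraidOrbits

open Set Function Filter Metric Complex
open Literature.Topology.FourManifolds Literature.Topology.FourManifolds.HandleAttachingMap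
  Literature.Topology.FourManifolds.LefschetzBase

variable {g : ℕ}

/-! ## §4 The flat part of the boundary off the cores is preconnected -/

section Main

variable {l : List ((Fin g ⊕ Fin g → ℤ) × Bool)} {h : Fin l.length → HandleAttachingMap 3 2 (Base g)}
  (hlink : IsLefschetzLink g l h)

/-- Solutions of `e^{it} = d` in an interval of length `< 2π` are unique. [folklore] -/
theorem exp_angle_unique {t t' : ℝ} (h : Complex.exp (Complex.I * t) = Complex.exp (Complex.I * t'))
    (hd : |t - t'| < 2 * π) : t = t' := by
  obtain ⟨n, hn⟩ := Complex.exp_eq_exp_iff_exists_int.1 h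
  have him := congrArg Complex.im hn
  simp at him
  have hdiff : t - t' = n * (2 * π) := by linarith
  rw [hdiff, abs_mul, abs_of_pos (by positivity : (0 : ℝ) < 2 * π)] at hd
  have hn1 : |(n : ℝ)| < 1 := by
    by_contra hc; push Not at hc; nlinarith [Real.pi_pos]
  have hn0 : n = 0 := by
    have : |n| < 1 := by exact_mod_cast hn1
    exact Int.abs_lt_one_iff.1 this
  rw [hn0] at hdiff; simp at hdiff; linarith

include hlink in
/-- **Sub-goal `helper_flatOffCores_preconnected`, structured form: `flatOff h` is preconnected.**
[cite: EtnyreFuller2006, Thm. 1 (proof, p. 8)] -/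
theorem isPreconnected_flatOff : IsPreconnected (flatOff h) := by
  classical
  rcases (flatOff h).eq_empty_or_nonempty with hemp | ⟨q₀, hq₀⟩
  · rw [hemp]; exact isPreconnected_empty
  obtain ⟨Rot, hRot⟩ := exists_pageRotation g
  set C : Set (Base g) := connectedComponentIn (flatOff h) q₀ with hC
  have hCsub : C ⊆ flatOff h := connectedComponentIn_subset _ _
  -- non-critical pages meeting `C` lie in `C`
  have page_in_C : ∀ c : ℂ, ‖c‖ = 1 → (∀ k : Fin l.length, c ≠ pageDir l.length k) →
      ∀ p ∈ C, w g p.1 = c / 2 → page g c ⊆ C := by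
    intro c hc hcrit p hpC hpw
    have hp : p ∈ page g c := by
      obtain ⟨⟨c', hc', hpc'⟩, -⟩ := hCsub hpC
      exact ⟨hpc'.1, hpw⟩
    have := (isPreconnected_page hc).subset_connectedComponentIn hp (page_subset_flatOff hlink hc hcrit)
    rwa [← connectedComponentIn_eq hpC] at this
  -- the set of realised angles is clopen in `ℝ`
  set T : Set ℝ := {t | ∃ p ∈ C, w g p.1 = Complex.exp (Complex.I * t) / 2} with hT
  have hunit : ∀ t : ℝ, ‖Complex.exp (Complex.I * t)‖ = 1 := fun t => by
    rw [show Complex.I * t = (t : ℂ) * Complex.I by ring, Complex.norm_exp_ofReal_mul_I]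
  have hexp_add : ∀ s t : ℝ, Complex.exp (Complex.I * s) * Complex.exp (Complex.I * t) =
      Complex.exp (Complex.I * ((s + t : ℝ) : ℂ)) := fun s t => by
    rw [← Complex.exp_add]; push_cast; ring_nf
  have hTopen : IsOpen T := by
    rw [Metric.isOpen_iff]
    rintro t ⟨p, hpC, hpw⟩
    obtain ⟨ε, hε, harc⟩ := exists_rot_arc hlink Rot hRot (hCsub hpC)
    refine ⟨ε, hε, fun t' ht' => ?_⟩
    have hs : |t' - t| < ε := by rw [Metric.mem_ball, Real.dist_eq] at ht'; exact ht'
    have hp : p ∈ page g (Complex.exp (Complex.I * t)) := by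
      obtain ⟨⟨c', hc', hpc'⟩, -⟩ := hCsub hpC
      exact ⟨hpc'.1, hpw⟩
    have hrot := hRot p _ (t' - t) hp
    rw [hexp_add, show t' - t + t = t' by ring] at hrot
    have hmem : Rot.toFun (t' - t) p ∈ C := rot_mem_component Rot harc hs hpC
    exact ⟨_, hmem, hrot.2⟩
  have hTclosed : IsClosed T := by
    apply isClosed_of_closure_subset
    intro t ht
    set c := Complex.exp (Complex.I * t) with hc_def
    obtain ⟨p₀, hp₀, hp₀cc⟩ := exists_mem_page_not_mem_cores hlink (hunit t)
    have hp₀f : p₀ ∈ flatOff h := ⟨⟨c, hunit t, hp₀⟩, hp₀cc⟩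
    obtain ⟨ε, hε, harc⟩ := exists_rot_arc hlink Rot hRot hp₀f
    have hε' : 0 < min ε π := lt_min hε Real.pi_pos
    -- a realised angle `t₁` close to `t`, then a realised NON-CRITICAL angle `t₂` close to `t`
    obtain ⟨t₁, ht₁T, ht₁⟩ := Metric.mem_closure_iff.1 ht (min ε π / 2) (by positivity)
    obtain ⟨δ, hδ, hδT⟩ := Metric.isOpen_iff.1 hTopen t₁ ht₁T
    set r := min δ (min ε π / 2) with hr
    have hr0 : 0 < r := lt_min hδ (by positivity)
    -- at most one bad angle per core index in `ball t₁ r`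
    have hbad : {s : ℝ | s ∈ ball t₁ r ∧ ∃ k : Fin l.length,
        Complex.exp (Complex.I * s) = pageDir l.length k}.Finite := by
      have hsub : {s : ℝ | s ∈ ball t₁ r ∧ ∃ k : Fin l.length, Complex.exp (Complex.I * s) = pageDir l.length k} ⊆
          ⋃ k : Fin l.length, {s : ℝ | s ∈ ball t₁ r ∧ Complex.exp (Complex.I * s) = pageDir l.length k} := by
        rintro s ⟨hs, k, hk⟩; exact mem_iUnion.2 ⟨k, hs, hk⟩
      refine (finite_iUnion fun k => ?_).subset hsub
      refine Set.Subsingleton.finite ?_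
      rintro s ⟨hs, hsk⟩ s' ⟨hs', hs'k⟩
      refine exp_angle_unique (hsk.trans hs'k.symm) ?_
      have h1 : dist s t₁ < r := hs
      have h2 : dist s' t₁ < r := hs'
      rw [Real.dist_eq] at h1 h2
      have hrπ : r ≤ π / 2 := by
        rw [hr]; refine (min_le_right _ _).trans ?_
        linarith [min_le_right ε π]
      calc |s - s'| = |(s - t₁) - (s' - t₁)| := by ring_nf
        _ ≤ |s - t₁| + |s' - t₁| := abs_sub _ _
        _ < 2 * π := by linarith [Real.pi_pos]
    have hinf : (ball t₁ r).Infinite := by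
      rw [Real.ball_eq_Ioo]; exact Set.Ioo_infinite (by linarith)
    obtain ⟨t₂, ht₂, ht₂bad⟩ := hinf.exists_notMem_finite hbad
    have ht₂T : t₂ ∈ T := hδT (ball_subset_ball (min_le_left _ _) ht₂)
    have ht₂crit : ∀ k : Fin l.length, Complex.exp (Complex.I * t₂) ≠ pageDir l.length k := by
      intro k hk; exact ht₂bad ⟨ht₂, k, hk⟩
    have ht₂t : |t₂ - t| < ε := by
      have h1 : dist t₂ t₁ < min ε π / 2 := lt_of_lt_of_le ht₂ (min_le_right _ _)
      have h2 : dist t t₁ < min ε π / 2 := ht₁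
      rw [Real.dist_eq] at h1 h2
      calc |t₂ - t| = |(t₂ - t₁) - (t - t₁)| := by ring_nf
        _ ≤ |t₂ - t₁| + |t - t₁| := abs_sub _ _
        _ < min ε π := by linarith
        _ ≤ ε := min_le_left _ _
    -- the whole page of angle `t₂` lies in `C`; rotate `p₀` into it
    obtain ⟨p₂, hp₂C, hp₂w⟩ := ht₂T
    have hpage₂ := page_in_C _ (hunit t₂) ht₂crit p₂ hp₂C hp₂w
    have hrot := hRot p₀ c (t₂ - t) hp₀
    rw [hc_def, hexp_add, show t₂ - t + t = t₂ by ring] at hrot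
    have hmem : p₀ ∈ C := mem_component_of_rot Rot harc ht₂t (hpage₂ hrot)
    exact ⟨p₀, hmem, hp₀.2⟩
  have hTne : T.Nonempty := by
    obtain ⟨⟨c, hc, hq₀c⟩, -⟩ := id hq₀
    refine ⟨Complex.arg c, q₀, mem_connectedComponentIn hq₀, ?_⟩
    rw [hq₀c.2, show Complex.I * (Complex.arg c : ℂ) = Complex.arg c * Complex.I by ring]
    conv_lhs => rw [← Complex.norm_mul_exp_arg_mul_I c, hc]
    simp
  have hTuniv : T = univ := IsClopen.eq_univ ⟨hTclosed, hTopen⟩ hTne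
  -- conclusion: every point of `flatOff h` lies in `C`
  have hall : flatOff h ⊆ C := by
    rintro q ⟨⟨c, hc, hqc⟩, hqcc⟩
    have hc_eq : Complex.exp (Complex.I * (Complex.arg c : ℂ)) = c := by
      rw [show Complex.I * (Complex.arg c : ℂ) = Complex.arg c * Complex.I by ring]
      conv_rhs => rw [← Complex.norm_mul_exp_arg_mul_I c, hc]
      simp
    by_cases hcrit : ∀ k : Fin l.length, c ≠ pageDir l.length k
    · have ht : Complex.arg c ∈ T := by rw [hTuniv]; exact mem_univ _
      obtain ⟨p, hpC, hpw⟩ := ht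
      rw [hc_eq] at hpw
      exact page_in_C c hc hcrit p hpC hpw hqc
    · -- critical page: rotate `q` slightly into a non-critical page, which lies in `C`
      obtain ⟨ε, hε, harc⟩ := exists_rot_arc hlink Rot hRot ⟨⟨c, hc, hqc⟩, hqcc⟩
      obtain ⟨ε₁, hε₁, hball⟩ := Metric.eventually_nhds_iff.1
        (eventually_rot_ne (fun k : Fin l.length => pageDir l.length k) c hc)
      set s := min ε ε₁ / 2 with hs
      have hs0 : 0 < s := by positivity
      have hsε : |s| < ε := by rw [abs_of_pos hs0, hs]; linarith [min_le_left ε ε₁]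
      have hsε₁ : dist s 0 < ε₁ := by
        rw [Real.dist_eq, sub_zero, abs_of_pos hs0, hs]; linarith [min_le_right ε ε₁]
      have hcrit' : ∀ k : Fin l.length, Complex.exp (Complex.I * s) * c ≠ pageDir l.length k :=
        hball hsε₁ hs0.ne'
      have hunit' : ‖Complex.exp (Complex.I * s) * c‖ = 1 := by rw [norm_mul, hunit, hc, mul_one]
      have ht : s + Complex.arg c ∈ T := by rw [hTuniv]; exact mem_univ _
      obtain ⟨p, hpC, hpw⟩ := ht
      rw [← hexp_add, hc_eq] at hpw
      have hpage := page_in_C _ hunit' hcrit' p hpC hpw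
      exact mem_component_of_rot Rot harc hsε (hpage (hRot q c s hqc))
  have heq : flatOff h = C := Subset.antisymm hall hCsub
  rw [heq]
  exact isPreconnected_connectedComponentIn

end Main

/-! ## §5 The statement on the boundary 3-manifold -/

/-- Flat boundary points lie on pages of unit direction: `c = 2 w`. [folklore] -/
theorem exists_mem_page_of_flat {q : Base g} (hflat : ‖cx q.1‖ ^ 2 < 4) (hρ : rho g q.1 = 1 / 4) :
    ∃ c : ℂ, ‖c‖ = 1 ∧ q ∈ page g c := by
  have hw : ‖w g q.1‖ = 1 / 2 := by
    have h1 : ‖w g q.1‖ ^ 2 = 1 / 4 := by rw [rho, eta_of_le hflat.le, add_zero] at hρ; exact hρ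
    have h2 : (0 : ℝ) ≤ ‖w g q.1‖ := norm_nonneg _
    nlinarith
  refine ⟨2 * w g q.1, by rw [norm_mul, hw]; norm_num, hflat, by ring⟩

/-- **Sub-goal `helper_flatOffCores_preconnected` of stub `stub_T3_dualPresentation`** (T3 ▸ T3c-2 ▸
ST4 `node_ST4_twistSign`, brick X3-4 (4c); wave 5, lead c5): for a Lefschetz link `h` on the base, the
set of points `y` of the boundary 3-manifold `(bBase g).carrier` which are flat (`‖x(y)‖² < 4`) and off
the cores is preconnected — the domain on which the twisting sign of ST4 is locally constant is
connected, so the sign is global. [cite: EtnyreFuller2006, Thm. 1 (proof, p. 8)] -/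
theorem helper_flatOffCores_preconnected : ∀ (g : ℕ) (l : List ((Fin g ⊕ Fin g → ℤ) × Bool)) (h : Fin l.length → Literature.Topology.FourManifolds.HandleAttachingMap 3 2 (Literature.Topology.FourManifolds.LefschetzBase.Base g)), Literature.Topology.FourManifolds.LefschetzBase.IsLefschetzLink g l h → IsPreconnected {y : (Literature.Topology.FourManifolds.LefschetzBase.bBase g).carrier | ‖Literature.Topology.FourManifolds.LefschetzBase.cx y.1.1‖ ^ 2 < 4 ∧ (y.1 : Literature.Topology.FourManifolds.LefschetzBase.Base g) ∈ Literature.Topology.FourManifolds.HandleAttachingMap.coresComplement h} := by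
  intro g l h hlink
  have hpre := isPreconnected_flatOff hlink
  -- the set is the preimage of `flatOff h` under the embedding `val : ∂ Base g → Base g`
  have heq : {y : (bBase g).carrier | ‖cx y.1.1‖ ^ 2 < 4 ∧ (y.1 : Base g) ∈ coresComplement h} =
      Subtype.val ⁻¹' flatOff h := by
    ext y
    constructor
    · rintro ⟨hflat, hcc⟩
      exact ⟨exists_mem_page_of_flat hflat ((RegularSublevel.mem_boundary_iff _ _).1 y.2), hcc⟩
    · rintro ⟨⟨c, hc, hyc⟩, hcc⟩
      exact ⟨hyc.1, hcc⟩
  rw [heq]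
  have himg : (Subtype.val : (bBase g).carrier → Base g) '' ((Subtype.val : (bBase g).carrier → Base g) ⁻¹'
      flatOff h) = flatOff h := by
    rw [image_preimage_eq_inter_range, inter_eq_left,
      show range (Subtype.val : (bBase g).carrier → Base g) = _ from (bBase g).range_incl]
    rintro q ⟨⟨c, hc, hqc⟩, -⟩
    exact page_subset_boundary g hc hqc
  have himg' : IsPreconnected ((Subtype.val : (bBase g).carrier → Base g) ''
      ((Subtype.val : (bBase g).carrier → Base g) ⁻¹' flatOff h)) := by
    rw [himg]; exact hpre
  exact (Topology.IsInducing.subtypeVal.isPreconnected_image).1 himg'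

end Summit.SmoothPoincare4.SmoothPoincare4.Theorems.AcyclicBisectionExists.ModpBraidOrbits

end
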